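import Summits.NavierStokesRegularity.NavierStokesRegularity.Theorems.ExtremiserTransienceNearExtremalTransienceExtremiserLiouvilleConstantSpeedJetBarycentreZero
import Mathlib.Analysis.Calculus.BumpFunction.FiniteDimension
import HarnessLib

/-!
# Crux `ExtremiserTransience.NearExtremalTransience` (stmt-NavierStokesRegularity-21883), line `extremiser_liouville`,
# stub K1b — **THE MULTIPLIER OF A RESIDUE JET HAS ZERO BARYCENTRE: `∫ v dμ = 0`**

`--supports stmt-NavierStokesRegularity-21883` (helper).  Author: prover seat `ns-el-k1b` (g5).  Completes `…ConstantSpeedJetBarycentreZero`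
(`⟪Ψ_φ(0), ∫v dμ⟫ = 0` for all `φ ∈ C_c^∞`, `Ψ_φ = ∇(∂₂φ) − (Δφ)e₂`) with the three bumps `φ = x₀x₂·χ`, `x₁x₂·χ`, `−½x₀²·χ`
(`χ` a smooth bump `≡ 1` near `0`), whose test vectors `Ψ_φ(0)` are `e₀, e₁, e₂`:

* `integral_eq_zero_of_jet` : for the residue JET in the axial frame (`v` smooth, divergence free, `‖v‖ ≡ M = ‖c‖`, `c = (0,0,c₂)`,
  `D¹v, D²v ∈ L²`, all slabs square integrable, window energies `≡ E₀` on `[0,1]`) and ANY finite measure `μ` with the multiplier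
  equation `S·J₁(φ) − κ⋆²M²(W a₁(φ) + Z c₁(φ)) = ∫⟪v, φ⟫dμ` on solenoidal tests: **`∫ v dμ = 0`**.

CONSEQUENCES (record §6; with g3's `…MultiplierIdentities` for the genuine multiplier): `∫⟪v, c⟫dμ = 0`, hence
`μ(ℝ³) = S²/M² = κ⋆²ZW` EXACTLY (the Hahn–Banach bound is attained), g3's angular moment `L_c = 0`, and the Stokeslet law reads
`κ⋆²M²W·R⁻²∫⟪v − c, (ΔΨ)(x/R)⟫ → 0`: every blow-down of a residue jet is Stokes-harmonic across the origin.

WHAT THIS IS NOT: K1b is NOT proved (the jet must still be excluded: compactness / flat case); nothing here proves NS regularity.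
[folklore]
-/

noncomputable section

open Set Filter Topology MeasureTheory Metric Function
open scoped ENNReal NNReal Topology InnerProductSpace RealInnerProductSpace ContDiff Laplacian
open Literature.Analysis.FluidPDE Literature.Analysis

namespace Summit.NavierStokesRegularity.NavierStokesRegularity.Theorems

-- the problem directory repeats the summit name (`NavierStokesRegularity/NavierStokesRegularity`)
set_option linter.dupNamespace false

namespace ExtremiserLiouville

open DepletionLadder.KStar DepletionLadder.KStar.HalfSpace

variable {v : E3 → E3} {c : E3} {φ q : E3 → ℝ}

/-! ## The test vector depends only on the germ of `φ` at `0` -/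

/-- If `φ = q` near `0` then `∂_w∂₂φ(0) = ∂_w∂₂q(0)`. [folklore] -/
theorem fderiv_fderiv_apply_congr_of_eventuallyEq (h : φ =ᶠ[𝓝 (0 : E3)] q) (a w : E3) :
    fderiv ℝ (fun z => fderiv ℝ φ z a) 0 w = fderiv ℝ (fun z => fderiv ℝ q z a) 0 w := by
  have h1 : (fun z => fderiv ℝ φ z a) =ᶠ[𝓝 (0 : E3)] fun z => fderiv ℝ q z a :=
    (h.fderiv (𝕜 := ℝ)).mono fun z hz => by
      show fderiv ℝ φ z a = fderiv ℝ q z a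
      rw [hz]
  rw [h1.fderiv_eq]

/-- If `φ = q` near `0` then `Δφ(0) = Δq(0)`. [folklore] -/
theorem laplacian_congr_of_eventuallyEq (h : φ =ᶠ[𝓝 (0 : E3)] q) : (Δ φ) (0 : E3) = (Δ q) (0 : E3) :=
  (InnerProductSpace.laplacian_congr_nhds h).eq_of_nhds

/-! ## The three model polynomials `x₀x₂`, `x₁x₂`, `−x₀²/2` -/

/-- `D(xᵢxⱼ)(z)·w = zᵢwⱼ + zⱼwᵢ`. [folklore] -/
theorem fderiv_coord_mul_coord (i j : Fin 3) (z w : E3) :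
    fderiv ℝ (fun y : E3 => y i * y j) z w = z i * w j + z j * w i := by
  have hi : HasFDerivAt (fun y : E3 => y i) (EuclideanSpace.proj i : E3 →L[ℝ] ℝ) z :=
    (EuclideanSpace.proj i : E3 →L[ℝ] ℝ).hasFDerivAt
  have hj : HasFDerivAt (fun y : E3 => y j) (EuclideanSpace.proj j : E3 →L[ℝ] ℝ) z :=
    (EuclideanSpace.proj j : E3 →L[ℝ] ℝ).hasFDerivAt
  rw [fderiv_fun_mul hi.differentiableAt hj.differentiableAt, hi.fderiv, hj.fderiv]
  rfl

/-- The coordinate product `xᵢxⱼ` is smooth. [folklore] -/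
theorem contDiff_coord_mul_coord (i j : Fin 3) : ContDiff ℝ ∞ fun y : E3 => y i * y j :=
  ((EuclideanSpace.proj i : E3 →L[ℝ] ℝ).contDiff).mul ((EuclideanSpace.proj j : E3 →L[ℝ] ℝ).contDiff)

/-- A linear form `u ↦ α uᵢ + β uⱼ` is its own derivative: `D(·)(0)·w = α wᵢ + β wⱼ`. [folklore] -/
theorem fderiv_lin_comb_coord (i j : Fin 3) (α β : ℝ) (w : E3) :
    fderiv ℝ (fun u : E3 => u i * α + u j * β) 0 w = w i * α + w j * β := by
  have hi : HasFDerivAt (fun y : E3 => y i) (EuclideanSpace.proj i : E3 →L[ℝ] ℝ) 0 :=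
    (EuclideanSpace.proj i : E3 →L[ℝ] ℝ).hasFDerivAt
  have hj : HasFDerivAt (fun y : E3 => y j) (EuclideanSpace.proj j : E3 →L[ℝ] ℝ) 0 :=
    (EuclideanSpace.proj j : E3 →L[ℝ] ℝ).hasFDerivAt
  have h : HasFDerivAt (fun u : E3 => u i * α + u j * β)
      (α • (EuclideanSpace.proj i : E3 →L[ℝ] ℝ) + β • (EuclideanSpace.proj j : E3 →L[ℝ] ℝ)) 0 :=
    (hi.mul_const α).add (hj.mul_const β)
  rw [h.fderiv]
  show α * w i + β * w j = w i * α + w j * β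
  ring

/-- **Model computation 1** (`i = 0` or `1`).  For `q = xᵢx₂`: `∂_w∂₂q(0) = wᵢ` and `Δq(0) = 0`. [folklore] -/
theorem model_coord_mul (i : Fin 3) (hi : i ≠ 2) :
    (∀ w : E3, fderiv ℝ (fun z => fderiv ℝ (fun y : E3 => y i * y 2) z (EuclideanSpace.single (2 : Fin 3) (1 : ℝ))) 0 w = w i) ∧
      (Δ (fun y : E3 => y i * y 2)) 0 = 0 := by
  have hs2 : (EuclideanSpace.single (2 : Fin 3) (1 : ℝ) : E3) 2 = 1 := by simp
  have hsi : (EuclideanSpace.single (2 : Fin 3) (1 : ℝ) : E3) i = 0 := by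
    fin_cases i
    · simp
    · simp
    · exact absurd rfl hi
  have hD2 : (fun z : E3 => fderiv ℝ (fun y : E3 => y i * y 2) z (EuclideanSpace.single (2 : Fin 3) (1 : ℝ))) =
      fun z => z i * 1 + z 2 * 0 := by
    funext z; rw [fderiv_coord_mul_coord, hs2, hsi]
  refine ⟨fun w => ?_, ?_⟩
  · rw [hD2, fderiv_lin_comb_coord]; ring
  · rw [congrFun (laplacian_eq_sum_fun ((contDiff_coord_mul_coord i 2).of_le (by norm_cast))) 0]
    refine Finset.sum_eq_zero fun k _ => ?_
    have hDk : (fun u : E3 => fderiv ℝ (fun y : E3 => y i * y 2) u (EuclideanSpace.basisFun (Fin 3) ℝ k)) =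
        fun u => u i * (EuclideanSpace.basisFun (Fin 3) ℝ k) 2 + u 2 * (EuclideanSpace.basisFun (Fin 3) ℝ k) i :=
      funext fun u => fderiv_coord_mul_coord i 2 u _
    rw [hDk, fderiv_lin_comb_coord]
    fin_cases i
    · fin_cases k <;> simp
    · fin_cases k <;> simp
    · exact absurd rfl hi

/-- `D(−½ x₀²)(z)·w = −z₀w₀`. [folklore] -/
theorem fderiv_neg_half_sq (z w : E3) :
    fderiv ℝ (fun y : E3 => -(1 / 2 : ℝ) * (y 0 * y 0)) z w = -(z 0 * w 0) := by
  have hd : DifferentiableAt ℝ (fun y : E3 => y 0 * y 0) z :=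
    ((contDiff_coord_mul_coord 0 0).differentiable (by simp)) z
  rw [fderiv_const_mul hd]
  show -(1 / 2 : ℝ) * fderiv ℝ (fun y : E3 => y 0 * y 0) z w = _
  rw [fderiv_coord_mul_coord]; ring

/-- `−½ x₀²` is smooth. [folklore] -/
theorem contDiff_neg_half_sq : ContDiff ℝ ∞ fun y : E3 => -(1 / 2 : ℝ) * (y 0 * y 0) :=
  contDiff_const.mul (contDiff_coord_mul_coord 0 0)

/-- **Model computation 2.**  For `q = −½x₀²`: `∂_w∂₂q(0) = 0` and `Δq(0) = −1`. [folklore] -/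
theorem model_neg_sq :
    (∀ w : E3, fderiv ℝ (fun z => fderiv ℝ (fun y : E3 => -(1 / 2 : ℝ) * (y 0 * y 0)) z
        (EuclideanSpace.single (2 : Fin 3) (1 : ℝ))) 0 w = 0) ∧
      (Δ (fun y : E3 => -(1 / 2 : ℝ) * (y 0 * y 0))) 0 = -1 := by
  have hs0 : (EuclideanSpace.single (2 : Fin 3) (1 : ℝ) : E3) 0 = 0 := by simp
  have hD2 : (fun z : E3 => fderiv ℝ (fun y : E3 => -(1 / 2 : ℝ) * (y 0 * y 0)) z
      (EuclideanSpace.single (2 : Fin 3) (1 : ℝ))) = fun _ => (0 : ℝ) := by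
    funext z; rw [fderiv_neg_half_sq, hs0, mul_zero, neg_zero]
  refine ⟨fun w => ?_, ?_⟩
  · rw [hD2, fderiv_fun_const]; rfl
  · rw [congrFun (laplacian_eq_sum_fun (contDiff_neg_half_sq.of_le (by norm_cast))) 0, Fin.sum_univ_three]
    have hDk : ∀ k : Fin 3, (fun u : E3 => fderiv ℝ (fun y : E3 => -(1 / 2 : ℝ) * (y 0 * y 0)) u
        (EuclideanSpace.basisFun (Fin 3) ℝ k)) = fun u => u 0 * (-(EuclideanSpace.basisFun (Fin 3) ℝ k) 0) + u 0 * 0 :=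
      fun k => funext fun u => by rw [fderiv_neg_half_sq]; ring
    rw [hDk 0, hDk 1, hDk 2, fderiv_lin_comb_coord, fderiv_lin_comb_coord, fderiv_lin_comb_coord]
    simp

/-! ## The barycentre vanishes -/

/-- **`∫ v dμ = 0` for the residue jet.**  Hypotheses as in `inner_testField_barycentre_eq_zero` (axial frame). [folklore] -/
theorem integral_eq_zero_of_jet (hv : ContDiff ℝ ∞ v) (hdiv : VectorCalculus.IsDivFree v) {M : ℝ}
    (hM : ∀ x, ‖v x‖ = M) (h1 : ∫⁻ x, ‖iteratedFDeriv ℝ 1 v x‖ₑ ^ 2 < ⊤) (h2 : ∫⁻ x, ‖iteratedFDeriv ℝ 2 v x‖ₑ ^ 2 < ⊤)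
    (μ : Measure E3) [IsFiniteMeasure μ]
    (hμ : ∀ ψ : E3 → E3, ContDiff ℝ ∞ ψ → HasCompactSupport ψ → VectorCalculus.IsDivFree ψ →
      Jst v * J1 v ψ - kStar ^ 2 * M ^ 2 * (Wpa v * A1 v ψ + Zen v * C1 v ψ) = ∫ x, ⟪v x, ψ x⟫_ℝ ∂μ)
    (hc0 : c 0 = 0) (hc1 : c 1 = 0) (hc2 : c 2 ≠ 0) (hcM : ‖c‖ = M)
    (hL2 : ∀ T : ℝ, Integrable (fun x => {x : E3 | |x 2| ≤ T}.indicator (fun x => ‖v x - c‖ ^ 2) x) volume)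
    {E₀ : ℝ} (hE : ∀ u ∈ Icc (0 : ℝ) 1, (∫ x : E3, deriv Real.smoothTransition (x 2 - u) * ‖v x - c‖ ^ 2) = E₀) :
    (∫ x, v x ∂μ) = 0 := by
  set b : E3 := ∫ x, v x ∂μ with hb
  -- a smooth bump `χ ≡ 1` near `0`
  let χ : ContDiffBump (0 : E3) := ⟨1, 2, one_pos, one_lt_two⟩
  have hχC : ContDiff ℝ ∞ (χ : E3 → ℝ) := χ.contDiff
  have hχc : HasCompactSupport (χ : E3 → ℝ) := χ.hasCompactSupport
  have hχ1 : (χ : E3 → ℝ) =ᶠ[𝓝 (0 : E3)] 1 := χ.eventuallyEq_one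
  -- the generic step: a bumped polynomial `χ·q` has the test vector of `q`
  have key : ∀ {q : E3 → ℝ}, ContDiff ℝ ∞ q →
      ⟪(fderiv ℝ (fun z => fderiv ℝ q z (EuclideanSpace.single (2 : Fin 3) (1 : ℝ))) 0 (EuclideanSpace.single (0 : Fin 3) (1 : ℝ))) •
          EuclideanSpace.single (0 : Fin 3) (1 : ℝ) +
        (fderiv ℝ (fun z => fderiv ℝ q z (EuclideanSpace.single (2 : Fin 3) (1 : ℝ))) 0 (EuclideanSpace.single (1 : Fin 3) (1 : ℝ))) •
          EuclideanSpace.single (1 : Fin 3) (1 : ℝ) +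
        (fderiv ℝ (fun z => fderiv ℝ q z (EuclideanSpace.single (2 : Fin 3) (1 : ℝ))) 0 (EuclideanSpace.single (2 : Fin 3) (1 : ℝ)) -
          (Δ q) 0) • EuclideanSpace.single (2 : Fin 3) (1 : ℝ), b⟫_ℝ = 0 := by
    intro q hq
    set φ' : E3 → ℝ := fun y => χ y * q y with hφ'
    have hφ'C : ContDiff ℝ ∞ φ' := hχC.mul hq
    have hφ'c : HasCompactSupport φ' := hχc.mul_right
    have heq : φ' =ᶠ[𝓝 (0 : E3)] q := by
      filter_upwards [hχ1] with y hy
      simp only [hφ', hy, Pi.one_apply, one_mul]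
    have h := inner_testField_barycentre_eq_zero hv hdiv hM h1 h2 μ hμ hc0 hc1 hc2 hcM hL2 hE hφ'C hφ'c
    rw [fderiv_fderiv_apply_congr_of_eventuallyEq heq, fderiv_fderiv_apply_congr_of_eventuallyEq heq,
      fderiv_fderiv_apply_congr_of_eventuallyEq heq, laplacian_congr_of_eventuallyEq heq] at h
    exact h
  -- the three components
  have hb0 : b 0 = 0 := by
    have h := key (contDiff_coord_mul_coord 0 2)
    obtain ⟨hw, hΔ⟩ := model_coord_mul 0 (by decide)
    rw [hw, hw, hw, hΔ] at h
    simpa [EuclideanSpace.inner_single_left] using h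
  have hb1 : b 1 = 0 := by
    have h := key (contDiff_coord_mul_coord 1 2)
    obtain ⟨hw, hΔ⟩ := model_coord_mul 1 (by decide)
    rw [hw, hw, hw, hΔ] at h
    simpa [EuclideanSpace.inner_single_left] using h
  have hb2 : b 2 = 0 := by
    have h := key contDiff_neg_half_sq
    obtain ⟨hw, hΔ⟩ := model_neg_sq
    rw [hw, hw, hw, hΔ] at h
    simpa [EuclideanSpace.inner_single_left] using h
  ext i
  fin_cases i
  · exact hb0
  · exact hb1
  · exact hb2

end ExtremiserLiouville

end Summit.NavierStokesRegularity.NavierStokesRegularity.Theorems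

end
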